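import Mathlib.Algebra.MvPolynomial.PDeriv
import Mathlib.Algebra.CharP.Lemmas
import Mathlib.Algebra.Polynomial.Eval.Defs
import Mathlib.Data.Fin.VecNotation
import Mathlib.Data.ZMod.Basic
import Mathlib.RingTheory.Ideal.Operations
import Mathlib.RingTheory.Polynomial.Basic
import Summits.ResolutionOfSingularities.ResolutionOfSingularities.Theorems.EquisingularLiftEquisingularLiftNatSpecimenSnuG7
import HarnessLib

/-!
# [OURS · L1 W4.5(b) · EL♮(3)] Specimen S♯_ν(G₇) — «THE SPACE ISLAND NOSE»: pointwise facts of the first certified NON-PLANAR nose customer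
# (kill side, res-L1-w45b-lead-1 g19; memo `L/res-L1-w45b-lead-1/SHARP7-CERTIFICATE.md`; crux `EquisingularLiftNatThree`, stmt-ResolutionOfSingularities-20148)

NOT a statement of any manuscript; OURS kernel specimen (cell `res-hironaka`, chain w45b).  AI-written, weaker than expert review.  Nothing of [Hironaka2017]
is asserted; EL♮(3) is NOT proved here; this file does NOT prove that S♯_ν(G₇) lies outside any typed class — that is the by-hand certificate of the memo
(persistence, no host, the cost ledger of SNU-ADDENDUM-A with LEMMA E / P, discrepancies in {1,2}).  It certifies, in the kernel, the finitely many POINTWISE and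
PARAMETRISATION facts the certificate and its panel replay rest on.

THE OBJECT.  Over `𝔽₇`: `q = x² − wz` (the quadric cone `Q`, vertex `e_y`), `h = y⁷ − w⁴z³ − 3wz⁶ − z⁷`, `A = 2x¹⁰ + x⁷y³ + y¹⁰ + z¹⁰ − 2y⁴z³w³ + 3w¹⁰`,
`F = h² + A·q²`, `S♯ = V(F) ⊂ ℙ³`; variables `X 0 = x, X 1 = y, X 2 = z, X 3 = w`.  The nose `Z′ = V(q, h)` is the planar island `G₇` re-embedded on the cone by
`u ↦ (u⁷ : u⁸ + 3u² + 1 : 1 : u¹⁴)`; its singular points are the seven cusps `q_r = (r : 4r² + 1 : 1 : r²)`, `r ∈ 𝔽₇`, and `e_w = (0:0:0:1)`.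
* `F_mem_sq`                    : `F ∈ (q, h)²` — `S♯` is singular along all of `Z′` (with kit j326900 (h): `Sing S♯ = Z′` exactly);
* `vertex_not_on_S`             : `F(e_y) = 1` — the vertex of the cone is off `S♯` (any ring);
* `par_q`, `par_h`              : the parametrisation lies on `Q` (any ring) and on `V(h)` (characteristic 7: `(u⁸ + 3u² + 1)⁷ = u⁵⁶ + 3u¹⁴ + 1`, Frobenius);
* `par_independent`             : `u⁷, u⁸ + 3u² + 1, 1, u¹⁴` are linearly independent over `𝔽₇` — no hyperplane contains the parametrised points (`Z′` is NON-PLANAR,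
                                  so the planar doors ν4/ν3ᵈ cannot take it and no hyperplane host contains it);
* `cusp_on_Z`, `ew_on_Z`        : `q` and `h` vanish at every `q_r` and at `e_w`;
* `pderiv_h_*` (helper `SpecimenSnuG7.pderiv_ofNat'` imported) : `∂ₓh = 0`, `∂_y h = 7y⁶`, `∂_z h = −3w⁴z² − 18wz⁵ − 7z⁶`, `∂_w h = −4w³z³ − 3z⁶` (any ring); `pderiv_q_*` likewise;
* `cusp_minors`, `ew_dh`        : at every `q_r` all `2 × 2` minors of the Jacobian of `(q, h)` vanish (so `Z′` is SINGULAR there: `dh = λ·dq`, `λ = 3·[r = 0]`), and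
                                  `dh(e_w) = 0`;
* `A_cusp`, `A_cusp_ne_zero`, `A_ew` : `A(q_r) = 2,3,4,2,3,1,5`, `A(e_w) = 3` — all `≠ 0` (so the strict transform `U² + A = 0` of the direct round misses the
                                  ambient-singular point `U = 0` over every singular point of `Z′`, memo §6);
* `lambda_sq_add_A_ne_zero`     : `λ_r² + A(q_r) ≠ 0` for every `r` — both formal sheets `h ± √(−A)·q` of `S♯` are SMOOTH at every cusp (LEMMA P's input, memo §3);
* `chart_U`, `chart_V`          : the two charts of the round at `Z′ = V(q,h)`.
Measured counterpart (kit j326900, `L/res-L1-w45b-lead-1/sharp7/`): `(q,h)` prime over `GF(7^d)`, `d ≤ 6`; Hilbert polynomial `14t − 35`; `Sing Z′` = the eight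
points exactly; pinch scheme `(q,h,A)` reduced of length 140; `F` irreducible over `GF(7^{1,2,6})`; `Sing S♯ = Z′`.
`--supports stmt-ResolutionOfSingularities-20148 --as helper`; def-free; standard axioms.
-/

set_option linter.dupNamespace false -- mandated namespace `Summit.<Summit>.<Problem>` of this single-conjunct summit
set_option linter.unusedSimpArgs false -- one shared `simp only` normal-form set for all the derivative lemmas below

noncomputable section

open MvPolynomial

namespace Summit.ResolutionOfSingularities.ResolutionOfSingularities.Cruxes.EquisingularLiftNat.Sections

namespace SpecimenSharpNuG7

section anyRing

variable (R : Type) [CommRing R]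

/-- [OURS · L1 W4.5b] `F = h² + A·q² ∈ (q, h)²`: `S♯` is singular along the whole nose `Z′ = V(q, h)`. [folklore] -/
theorem F_mem_sq :
    ((X 1 ^ 7 - X 3 ^ 4 * X 2 ^ 3 - 3 * X 3 * X 2 ^ 6 - X 2 ^ 7) ^ 2 +
        (2 * X 0 ^ 10 + X 0 ^ 7 * X 1 ^ 3 + X 1 ^ 10 + X 2 ^ 10 - 2 * X 1 ^ 4 * X 2 ^ 3 * X 3 ^ 3 + 3 * X 3 ^ 10) *
          (X 0 ^ 2 - X 3 * X 2) ^ 2 : MvPolynomial (Fin 4) R) ∈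
      (Ideal.span {(X 0 ^ 2 - X 3 * X 2 : MvPolynomial (Fin 4) R), X 1 ^ 7 - X 3 ^ 4 * X 2 ^ 3 - 3 * X 3 * X 2 ^ 6 - X 2 ^ 7}) ^ 2 := by
  have hq : (X 0 ^ 2 - X 3 * X 2 : MvPolynomial (Fin 4) R) ∈
      Ideal.span {(X 0 ^ 2 - X 3 * X 2 : MvPolynomial (Fin 4) R), X 1 ^ 7 - X 3 ^ 4 * X 2 ^ 3 - 3 * X 3 * X 2 ^ 6 - X 2 ^ 7} :=
    Ideal.subset_span (Set.mem_insert _ _)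
  have hh : (X 1 ^ 7 - X 3 ^ 4 * X 2 ^ 3 - 3 * X 3 * X 2 ^ 6 - X 2 ^ 7 : MvPolynomial (Fin 4) R) ∈
      Ideal.span {(X 0 ^ 2 - X 3 * X 2 : MvPolynomial (Fin 4) R), X 1 ^ 7 - X 3 ^ 4 * X 2 ^ 3 - 3 * X 3 * X 2 ^ 6 - X 2 ^ 7} :=
    Ideal.subset_span (Set.mem_insert_of_mem _ (Set.mem_singleton _))
  exact Ideal.add_mem _ (Ideal.pow_mem_pow hh 2) (Ideal.mul_mem_left _ _ (Ideal.pow_mem_pow hq 2))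

/-- [OURS · L1 W4.5b] The vertex `e_y = (0:1:0:0)` of the cone is NOT on `S♯`: `F(e_y) = 1`. [folklore] -/
theorem vertex_not_on_S :
    eval ![(0 : R), 1, 0, 0]
        ((X 1 ^ 7 - X 3 ^ 4 * X 2 ^ 3 - 3 * X 3 * X 2 ^ 6 - X 2 ^ 7) ^ 2 +
          (2 * X 0 ^ 10 + X 0 ^ 7 * X 1 ^ 3 + X 1 ^ 10 + X 2 ^ 10 - 2 * X 1 ^ 4 * X 2 ^ 3 * X 3 ^ 3 + 3 * X 3 ^ 10) *
            (X 0 ^ 2 - X 3 * X 2) ^ 2 : MvPolynomial (Fin 4) R) = 1 := by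
  simp [eval_X]

/-- [OURS · L1 W4.5b] The parametrisation `u ↦ (u⁷, u⁸ + 3u² + 1, 1, u¹⁴)` lies on the cone `Q = V(x² − wz)` (any ring). [folklore] -/
theorem par_q (u : R) : (u ^ 7) ^ 2 - u ^ 14 * 1 = 0 := by ring

/-- [OURS · L1 W4.5b] Chart `h = qU` of the round at `Z′`: `(qU)² + A·q² = q²(U² + A)`. [folklore] -/
theorem chart_U (q U A : R) : (q * U) ^ 2 + A * q ^ 2 = q ^ 2 * (U ^ 2 + A) := by ring

/-- [OURS · L1 W4.5b] Chart `q = hV`: `h² + A(hV)² = h²(1 + V²A)`. [folklore] -/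
theorem chart_V (h V A : R) : h ^ 2 + A * (h * V) ^ 2 = h ^ 2 * (1 + V ^ 2 * A) := by ring

/-- [OURS · L1 W4.5b] `∂ₓ h = 0` (`h` does not involve `x`). [folklore] -/
theorem pderiv_h_x :
    pderiv 0 (X 1 ^ 7 - X 3 ^ 4 * X 2 ^ 3 - 3 * X 3 * X 2 ^ 6 - X 2 ^ 7 : MvPolynomial (Fin 4) R) = 0 := by
  simp only [map_sub, Derivation.leibniz, Derivation.leibniz_pow, pderiv_X_of_ne (i := (0 : Fin 4)) (j := 1) (by decide), pderiv_X_of_ne (i := (0 : Fin 4)) (j := 2) (by decide), pderiv_X_of_ne (i := (0 : Fin 4)) (j := 3) (by decide), SpecimenSnuG7.pderiv_ofNat',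
    smul_eq_mul, nsmul_eq_mul, Nat.cast_ofNat, mul_one, one_mul, mul_zero, zero_mul, add_zero, zero_add, sub_zero, zero_sub, smul_zero, pow_one, neg_zero]

/-- [OURS · L1 W4.5b] `∂_y h = 7y⁶` (≡ 0 in characteristic 7). [folklore] -/
theorem pderiv_h_y :
    pderiv 1 (X 1 ^ 7 - X 3 ^ 4 * X 2 ^ 3 - 3 * X 3 * X 2 ^ 6 - X 2 ^ 7 : MvPolynomial (Fin 4) R) = 7 * X 1 ^ 6 := by
  simp only [map_sub, Derivation.leibniz, Derivation.leibniz_pow, pderiv_X_self, pderiv_X_of_ne (i := (1 : Fin 4)) (j := 2) (by decide), pderiv_X_of_ne (i := (1 : Fin 4)) (j := 3) (by decide), SpecimenSnuG7.pderiv_ofNat',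
    smul_eq_mul, nsmul_eq_mul, Nat.cast_ofNat, mul_one, one_mul, mul_zero, zero_mul, add_zero, zero_add, sub_zero, zero_sub, smul_zero, pow_one, neg_zero]

/-- [OURS · L1 W4.5b] `∂_z h = −3w⁴z² − 18wz⁵ − 7z⁶`. [folklore] -/
theorem pderiv_h_z :
    pderiv 2 (X 1 ^ 7 - X 3 ^ 4 * X 2 ^ 3 - 3 * X 3 * X 2 ^ 6 - X 2 ^ 7 : MvPolynomial (Fin 4) R) =
      -(3 * X 3 ^ 4 * X 2 ^ 2) - 18 * X 3 * X 2 ^ 5 - 7 * X 2 ^ 6 := by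
  simp only [map_sub, Derivation.leibniz, Derivation.leibniz_pow, pderiv_X_self, pderiv_X_of_ne (i := (2 : Fin 4)) (j := 1) (by decide), pderiv_X_of_ne (i := (2 : Fin 4)) (j := 3) (by decide), SpecimenSnuG7.pderiv_ofNat',
    smul_eq_mul, nsmul_eq_mul, Nat.cast_ofNat, mul_one, one_mul, mul_zero, zero_mul, add_zero, zero_add, sub_zero, zero_sub, smul_zero, pow_one, neg_zero]
  all_goals ring

/-- [OURS · L1 W4.5b] `∂_w h = −4w³z³ − 3z⁶`. [folklore] -/
theorem pderiv_h_w :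
    pderiv 3 (X 1 ^ 7 - X 3 ^ 4 * X 2 ^ 3 - 3 * X 3 * X 2 ^ 6 - X 2 ^ 7 : MvPolynomial (Fin 4) R) =
      -(4 * X 3 ^ 3 * X 2 ^ 3) - 3 * X 2 ^ 6 := by
  simp only [map_sub, Derivation.leibniz, Derivation.leibniz_pow, pderiv_X_self, pderiv_X_of_ne (i := (3 : Fin 4)) (j := 1) (by decide), pderiv_X_of_ne (i := (3 : Fin 4)) (j := 2) (by decide), SpecimenSnuG7.pderiv_ofNat',
    smul_eq_mul, nsmul_eq_mul, Nat.cast_ofNat, mul_one, one_mul, mul_zero, zero_mul, add_zero, zero_add, sub_zero, zero_sub, smul_zero, pow_one, neg_zero]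
  all_goals ring

/-- [OURS · L1 W4.5b] `∂ₓ q = 2x`. [folklore] -/
theorem pderiv_q_x : pderiv 0 (X 0 ^ 2 - X 3 * X 2 : MvPolynomial (Fin 4) R) = 2 * X 0 := by
  simp only [map_sub, Derivation.leibniz, Derivation.leibniz_pow, pderiv_X_self, pderiv_X_of_ne (i := (0 : Fin 4)) (j := 2) (by decide), pderiv_X_of_ne (i := (0 : Fin 4)) (j := 3) (by decide),
    smul_eq_mul, nsmul_eq_mul, Nat.cast_ofNat, mul_one, one_mul, mul_zero, zero_mul, add_zero, zero_add, sub_zero, zero_sub, smul_zero, pow_one, neg_zero]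
  all_goals ring

/-- [OURS · L1 W4.5b] `∂_y q = 0`. [folklore] -/
theorem pderiv_q_y : pderiv 1 (X 0 ^ 2 - X 3 * X 2 : MvPolynomial (Fin 4) R) = 0 := by
  simp only [map_sub, Derivation.leibniz, Derivation.leibniz_pow, pderiv_X_of_ne (i := (1 : Fin 4)) (j := 0) (by decide), pderiv_X_of_ne (i := (1 : Fin 4)) (j := 2) (by decide), pderiv_X_of_ne (i := (1 : Fin 4)) (j := 3) (by decide),
    smul_eq_mul, nsmul_eq_mul, Nat.cast_ofNat, mul_one, one_mul, mul_zero, zero_mul, add_zero, zero_add, sub_zero, zero_sub, smul_zero, pow_one, neg_zero]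

/-- [OURS · L1 W4.5b] `∂_z q = −w`. [folklore] -/
theorem pderiv_q_z : pderiv 2 (X 0 ^ 2 - X 3 * X 2 : MvPolynomial (Fin 4) R) = -X 3 := by
  simp only [map_sub, Derivation.leibniz, Derivation.leibniz_pow, pderiv_X_self, pderiv_X_of_ne (i := (2 : Fin 4)) (j := 0) (by decide), pderiv_X_of_ne (i := (2 : Fin 4)) (j := 3) (by decide),
    smul_eq_mul, nsmul_eq_mul, Nat.cast_ofNat, mul_one, one_mul, mul_zero, zero_mul, add_zero, zero_add, sub_zero, zero_sub, smul_zero, pow_one, neg_zero]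

/-- [OURS · L1 W4.5b] `∂_w q = −z`. [folklore] -/
theorem pderiv_q_w : pderiv 3 (X 0 ^ 2 - X 3 * X 2 : MvPolynomial (Fin 4) R) = -X 2 := by
  simp only [map_sub, Derivation.leibniz, Derivation.leibniz_pow, pderiv_X_self, pderiv_X_of_ne (i := (3 : Fin 4)) (j := 0) (by decide), pderiv_X_of_ne (i := (3 : Fin 4)) (j := 2) (by decide),
    smul_eq_mul, nsmul_eq_mul, Nat.cast_ofNat, mul_one, one_mul, mul_zero, zero_mul, add_zero, zero_add, sub_zero, zero_sub, smul_zero, pow_one, neg_zero]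

end anyRing

/-! ## Over the prime field `𝔽₇` -/

section charSeven

/-- [OURS · L1 W4.5b] `(3 : 𝔽₇)⁷ = 3` (Fermat). [folklore] -/
theorem three_pow_seven : ((3 : ZMod 7)) ^ 7 = 3 := by decide

/-- [OURS · L1 W4.5b] The parametrisation lies on `V(h)` in characteristic 7: `(u⁸ + 3u² + 1)⁷ − (u¹⁴)⁴·1 − 3·u¹⁴·1 − 1 = 0` — Frobenius:
`(u⁸ + 3u² + 1)⁷ = u⁵⁶ + 3⁷u¹⁴ + 1` and `3⁷ = 3`. [folklore] -/
theorem par_h (u : ZMod 7) : (u ^ 8 + 3 * u ^ 2 + 1) ^ 7 - (u ^ 14) ^ 4 * 1 ^ 3 - 3 * u ^ 14 * 1 ^ 6 - 1 ^ 7 = 0 := by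
  haveI : Fact (Nat.Prime 7) := ⟨by decide⟩
  have h1 : (u ^ 8 + 3 * u ^ 2 + 1) ^ 7 = (u ^ 8 + 3 * u ^ 2) ^ 7 + 1 ^ 7 := add_pow_char _ _ 7
  have h2 : (u ^ 8 + 3 * u ^ 2) ^ 7 = (u ^ 8) ^ 7 + (3 * u ^ 2) ^ 7 := add_pow_char _ _ 7
  rw [h1, h2, mul_pow, three_pow_seven]
  ring

/-- [OURS · L1 W4.5b] NON-PLANARITY at the level of the parametrisation: if a linear form `a·x + b·y + c·z + d·w` vanishes on
`(u⁷, u⁸ + 3u² + 1, 1, u¹⁴)` identically in `u` (as a polynomial over `𝔽₇`), then `a = b = c = d = 0`.  So no hyperplane contains `Z′`: the planar doors ν4/ν3ᵈ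
cannot take it and no hyperplane host contains `Z′^st` (memo §4.2, §5). [folklore] -/
theorem par_independent (a b c d : ZMod 7)
    (h0 : (Polynomial.C a * Polynomial.X ^ 7 + Polynomial.C b * (Polynomial.X ^ 8 + 3 * Polynomial.X ^ 2 + 1) + Polynomial.C c +
        Polynomial.C d * Polynomial.X ^ 14 : Polynomial (ZMod 7)) = 0) :
    a = 0 ∧ b = 0 ∧ c = 0 ∧ d = 0 := by
  have e14 := congrArg (fun P : Polynomial (ZMod 7) => P.coeff 14) h0
  have e8 := congrArg (fun P : Polynomial (ZMod 7) => P.coeff 8) h0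
  have e7 := congrArg (fun P : Polynomial (ZMod 7) => P.coeff 7) h0
  have e0 := congrArg (fun P : Polynomial (ZMod 7) => P.coeff 0) h0
  simp only [Polynomial.coeff_add, Polynomial.coeff_C_mul, Polynomial.coeff_X_pow, Polynomial.coeff_C, Polynomial.coeff_one,
    Polynomial.coeff_zero, mul_add, Polynomial.coeff_ofNat_mul] at e14 e8 e7 e0
  norm_num at e14 e8 e7 e0
  refine ⟨e7, e8, ?_, e14⟩
  rw [e8] at e0; simpa using e0

/-- [OURS · L1 W4.5b] Every `q_r = (r, 4r² + 1, 1, r²)`, `r ∈ 𝔽₇`, lies on `Z′ = V(q, h)`. [folklore] -/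
theorem cusp_on_Z (r : ZMod 7) :
    eval ![r, 4 * r ^ 2 + 1, 1, r ^ 2] (X 0 ^ 2 - X 3 * X 2 : MvPolynomial (Fin 4) (ZMod 7)) = 0 ∧
    eval ![r, 4 * r ^ 2 + 1, 1, r ^ 2] (X 1 ^ 7 - X 3 ^ 4 * X 2 ^ 3 - 3 * X 3 * X 2 ^ 6 - X 2 ^ 7 : MvPolynomial (Fin 4) (ZMod 7)) = 0 := by
  simp only [map_sub, map_mul, map_pow, eval_X, map_ofNat, Matrix.cons_val_zero, Matrix.cons_val_one, Matrix.cons_val_two,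
    Matrix.cons_val_three, Matrix.tail_cons, Matrix.head_cons]
  revert r; decide

/-- [OURS · L1 W4.5b] `e_w = (0:0:0:1)` lies on `Z′`. [folklore] -/
theorem ew_on_Z :
    eval ![(0 : ZMod 7), 0, 0, 1] (X 0 ^ 2 - X 3 * X 2 : MvPolynomial (Fin 4) (ZMod 7)) = 0 ∧
    eval ![(0 : ZMod 7), 0, 0, 1] (X 1 ^ 7 - X 3 ^ 4 * X 2 ^ 3 - 3 * X 3 * X 2 ^ 6 - X 2 ^ 7 : MvPolynomial (Fin 4) (ZMod 7)) = 0 := by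
  constructor <;> simp [eval_X]

/-- [OURS · L1 W4.5b] `Z′` IS SINGULAR at every `q_r`: all `2 × 2` minors `∂_i q·∂_j h − ∂_j q·∂_i h` of the Jacobian of `(q, h)` vanish there
(`dh(q_r) = λ_r·dq(q_r)` with `λ_0 = 3`, `λ_r = 0` for `r ≠ 0`; `dq(q_r) = (2r, 0, −r², −1) ≠ 0`). [folklore] -/
theorem cusp_minors (r : ZMod 7) (i j : Fin 4) :
    eval ![r, 4 * r ^ 2 + 1, 1, r ^ 2] (pderiv i (X 0 ^ 2 - X 3 * X 2 : MvPolynomial (Fin 4) (ZMod 7))) *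
        eval ![r, 4 * r ^ 2 + 1, 1, r ^ 2] (pderiv j (X 1 ^ 7 - X 3 ^ 4 * X 2 ^ 3 - 3 * X 3 * X 2 ^ 6 - X 2 ^ 7 : MvPolynomial (Fin 4) (ZMod 7))) -
      eval ![r, 4 * r ^ 2 + 1, 1, r ^ 2] (pderiv j (X 0 ^ 2 - X 3 * X 2 : MvPolynomial (Fin 4) (ZMod 7))) *
        eval ![r, 4 * r ^ 2 + 1, 1, r ^ 2] (pderiv i (X 1 ^ 7 - X 3 ^ 4 * X 2 ^ 3 - 3 * X 3 * X 2 ^ 6 - X 2 ^ 7 : MvPolynomial (Fin 4) (ZMod 7))) = 0 := by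
  fin_cases i <;> fin_cases j <;>
    simp only [Fin.zero_eta, Fin.mk_one, Fin.reduceFinMk, pderiv_q_x, pderiv_q_y, pderiv_q_z, pderiv_q_w, pderiv_h_x, pderiv_h_y, pderiv_h_z,
      pderiv_h_w] <;>
    simp only [map_sub, map_neg, map_mul, map_pow, map_zero, eval_X, map_ofNat, Matrix.cons_val_zero, Matrix.cons_val_one,
      Matrix.cons_val_two, Matrix.cons_val_three, Matrix.tail_cons, Matrix.head_cons] <;>
    revert r <;> decide

/-- [OURS · L1 W4.5b] `Z′` is singular at `e_w` too: `dh(e_w) = 0` (all four partials of `h` vanish at `(0,0,0,1)`; `h ∈ 𝔪³` there, type `⟨6,7⟩`). [folklore] -/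
theorem ew_dh (j : Fin 4) :
    eval ![(0 : ZMod 7), 0, 0, 1] (pderiv j (X 1 ^ 7 - X 3 ^ 4 * X 2 ^ 3 - 3 * X 3 * X 2 ^ 6 - X 2 ^ 7 : MvPolynomial (Fin 4) (ZMod 7))) = 0 := by
  fin_cases j <;>
    simp [pderiv_h_x, pderiv_h_y, pderiv_h_z, pderiv_h_w, eval_X]

/-- [OURS · L1 W4.5b] `A(q_r) = 2, 3, 4, 2, 3, 1, 5` for `r = 0, …, 6` (kit j326900 (c)). [folklore] -/
theorem A_cusp (r : ZMod 7) :
    eval ![r, 4 * r ^ 2 + 1, 1, r ^ 2]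
        (2 * X 0 ^ 10 + X 0 ^ 7 * X 1 ^ 3 + X 1 ^ 10 + X 2 ^ 10 - 2 * X 1 ^ 4 * X 2 ^ 3 * X 3 ^ 3 + 3 * X 3 ^ 10 : MvPolynomial (Fin 4) (ZMod 7)) =
      (![2, 3, 4, 2, 3, 1, 5] : Fin 7 → ZMod 7) r := by
  simp only [map_add, map_sub, map_mul, map_pow, eval_X, map_ofNat, Matrix.cons_val_zero, Matrix.cons_val_one, Matrix.cons_val_two,
    Matrix.cons_val_three, Matrix.tail_cons, Matrix.head_cons]
  revert r; decide

/-- [OURS · L1 W4.5b] … all non-zero: over each cusp the strict transform `U² + A = 0` of the direct round misses the ambient-singular point `U = 0`. [folklore] -/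
theorem A_cusp_ne_zero (r : ZMod 7) :
    eval ![r, 4 * r ^ 2 + 1, 1, r ^ 2]
        (2 * X 0 ^ 10 + X 0 ^ 7 * X 1 ^ 3 + X 1 ^ 10 + X 2 ^ 10 - 2 * X 1 ^ 4 * X 2 ^ 3 * X 3 ^ 3 + 3 * X 3 ^ 10 : MvPolynomial (Fin 4) (ZMod 7)) ≠ 0 := by
  rw [A_cusp]; revert r; decide

/-- [OURS · L1 W4.5b] `A(e_w) = 3 ≠ 0`. [folklore] -/
theorem A_ew :
    eval ![(0 : ZMod 7), 0, 0, 1]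
        (2 * X 0 ^ 10 + X 0 ^ 7 * X 1 ^ 3 + X 1 ^ 10 + X 2 ^ 10 - 2 * X 1 ^ 4 * X 2 ^ 3 * X 3 ^ 3 + 3 * X 3 ^ 10 : MvPolynomial (Fin 4) (ZMod 7)) = 3 := by
  simp [eval_X]

/-- [OURS · L1 W4.5b] **Both formal sheets are smooth at every cusp**: `λ_r² + A(q_r) ≠ 0` (`λ_0 = 3`, `λ_r = 0` otherwise), so `d(h ± √(−A)·q)(q_r) =
(λ_r ± √(−A))·dq(q_r) ≠ 0` — the input of LEMMA P of the cost ledger (memo §3–§4). [folklore] -/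
theorem lambda_sq_add_A_ne_zero (r : ZMod 7) :
    (if r = 0 then (3 : ZMod 7) else 0) ^ 2 +
        eval ![r, 4 * r ^ 2 + 1, 1, r ^ 2]
          (2 * X 0 ^ 10 + X 0 ^ 7 * X 1 ^ 3 + X 1 ^ 10 + X 2 ^ 10 - 2 * X 1 ^ 4 * X 2 ^ 3 * X 3 ^ 3 + 3 * X 3 ^ 10 : MvPolynomial (Fin 4) (ZMod 7)) ≠ 0 := by
  rw [A_cusp]; revert r; decide

/-- [OURS · L1 W4.5b] The value of `λ_r`: `∂_w h(q_r) = λ_r·∂_w q(q_r)` with `∂_w q(q_r) = −1`, i.e. `∂_w h(q_r) = −λ_r = −3·[r = 0]`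
(the `x`-, `y`-, `z`-components of `dh(q_r)` vanish: `cusp_minors` / `pderiv_h_x` / `7 = 0` / `−7r² = 0`). [folklore] -/
theorem dh_w_cusp (r : ZMod 7) :
    eval ![r, 4 * r ^ 2 + 1, 1, r ^ 2] (pderiv 3 (X 1 ^ 7 - X 3 ^ 4 * X 2 ^ 3 - 3 * X 3 * X 2 ^ 6 - X 2 ^ 7 : MvPolynomial (Fin 4) (ZMod 7))) =
      -(if r = 0 then (3 : ZMod 7) else 0) := by
  rw [pderiv_h_w]
  simp only [map_sub, map_neg, map_mul, map_pow, eval_X, map_ofNat, Matrix.cons_val_two, Matrix.cons_val_three, Matrix.tail_cons,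
    Matrix.head_cons]
  revert r; decide

end charSeven

end SpecimenSharpNuG7

end Summit.ResolutionOfSingularities.ResolutionOfSingularities.Cruxes.EquisingularLiftNat.Sections

end
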